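import Summits.QuantumFields.BalabanUV.Gaps.D1ParityOddFirstMoments

/-!
# `BalabanUV.Gaps.D1WardLongitudinalForm` — cell pub-balaban-gaps, row (D1), seat g1-p1: UNDER THE WARD BINDER ALONE, THE (1.22) COEFFICIENT OF EITHER LITERAL IS −½ × THE LONGITUDINAL
# SECOND MOMENT OF A DIAGONAL CHANNEL AND IS ≥ 0 UNDER THE PSD OF THE CONVOLUTION FORM — the β sub-cell's «Lemma 5.2» identities AT BOTH LITERALS WITH THE REFLECTION BINDER `hR` REMOVED;
# (D1) under `hW` is a statement about ONE DIAGONAL CHANNEL of the pinned family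

HONEST FRAMING (cell rule, page 1 of everything): [folklore] composition BY NAME — the β sub-cell's `PolarizationSign.secondMoment_eq_neg_half ∕ secondMoment_nonneg ∕ secondMoment_comm`
(an2: the cubic Ward identity + Bochner on boxes; their first-moment input `Σ_z P_{αβ}(z) z_β = 0` was supplied there by the reflection covariance (5.7), `first_moment_eq_zero`), GEN 15's
`D1ParityOddFirstMoments.firstMoment_eq_zero_of_ward_indexSymmetric_of_not_injective` (under (5.9) + (5.8) + summable third moments EVERY first moment with a repeated label vanishes — in
particular that input), GEN 14's `indexSymmetric_flipK_TbalOf_JsBalAn1 ∕ _JsB12CombShSym` ((5.8) is a THEOREM at both literals) and `momentSummable_flipK_TbalOf` (a THEOREM for every jet-data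
family), an4's `OneStepKernelFamily.secondMoment_flipK`, g1-p3's `CapTailPinnedLimitSign.tendsto_pinned ∕ d1Drift_pinned_iff_lim_eq`.  The Ward binder `hW : WardTransversal (flipK (TbalOf … j))`
((5.9), the END's displayed hypothesis) and the positive semi-definiteness `ConvPSD (flipK (TbalOf … j))` (the β sub-cell's Lemma 5.2 hypothesis (ii); NOT printed for the full `Π`) REMAIN
HYPOTHESES on members of the cells' OWN literals ((P6) undecided) — NOT proved here for any member; (5.7)–(5.9) are PRINTED for Bałaban's `Π` [Balaban1987RG1 p. 293] and used as predicates only.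
NOTHING of Bałaban's asserted beyond print; NO coefficient computed or signed; (D1) NOT discharged; 0∕4 row-D1 binders; NOT `BetaPertH`, NOT continuum, NOT Clay.
HONEST DEPENDENCY (b2b cell, verbatim): «continuum YM on T⁴ ⇐ BetaPertH ∧ nine spine estimates (0/9 proved); BetaPertH ⇐ (D1) ∧ (D4) ∧ CAP+tail; G-an2-4 gates asym, D1 and NE2/3/4.»

WHY (census row 86 of `HOME/g1/RESIDUE.md`).  The wall's END `OneStepKernelFamily.d1Drift_of_D1Tel_D1Rep` displays `hW` (5.9) AND `hR` (5.7); GEN 15 located what `hR` buys inside the drift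
socket (four parity-odd first moments per level).  This file records what `hR` buys for the (1.22) COEFFICIENT ITSELF — the quantity (D1) is about: NOTHING.  Under `hW` at ONE level `j`
(with (5.8) and moment summability, both theorems) the β sub-cell's Lemma 5.2 identities hold at that level WITHOUT `hR`:
`β⁰_j(μ,ν) = secondMoment (T_j) μ ν = −½ Σ_z T_j(ν,ν,z) z_μ² = −½ Σ_z T_j(μ,μ,z) z_ν² = −¼ (both)` (`μ ≠ ν`), and `0 ≤ β⁰_j(μ,ν)` if the convolution form of `flipK T_j` is PSD.  So the
off-diagonal (1.22) coefficient of the pinned family — and of the (III′) literal — is READ ON ONE DIAGONAL CHANNEL (the longitudinal second moment of `T_j(ν,ν,·)` along `μ`), the two diagonal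
readings agree, and together with GEN 14's diagonal-momentum estimator (`D1IndexSymmetryDictionary`) every level coefficient has THREE kernel-exact estimators under `hW` alone (an Engine-C
consistency check of zero cost).  AT THE PIN (`cE₂ = Lc^8`, `2 ≤ Lc`; the limit exists hypothesis-free, g1-p3): under `∀ j, hW_j`, **(D1) ⟺ the diagonal longitudinal moments
`Σ_z T_j(ν,ν,z) z_μ²` TEND TO `−2·stepBal N Lc`** (`d1Drift_iff_tendsto_longitudinal_of_hW`), equivalently their `CauchyRate.lim` is `−2·stepBal N Lc`; and under `∀ j, hW_j ∧ PSD_j` the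
constructed limit `lim β⁰(μ,ν)` is `≥ 0` (`lim_secondMoment_nonneg_of_hW_convPSD`) — the SIGN half of the β sub-cell's Lemma 5.2 reaches the (D1) limit with `hR` nowhere.
WHAT IT IS NOT: `hW`, `ConvPSD`, `D1Tel`, `D1Rep` remain HYPOTHESES; no binder of row D1 is discharged; the words of the row do not move.

CONTENT (all [folklore]; no `def`, no `def … : Prop`, 0 sorry): §1 generic kernel `P : B12Beta.Kernel d` under {`MomentSummable P 3`, `WardTransversal P`, `IndexSymmetric P`}:
`firstMoment_inPlane_eq_zero`, **`secondMoment_eq_neg_half_of_ward_indexSymmetric`** (right diagonal channel), `secondMoment_eq_neg_half_left_of_ward_indexSymmetric` (left), 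
**`secondMoment_eq_neg_quarter_of_ward_indexSymmetric`**, `longitudinalMoment_diag_comm` (the two diagonal readings agree), **`secondMoment_nonneg_of_ward_indexSymmetric_convPSD`** (Lemma 5.2's
conclusion `0 ≤ β` WITHOUT (5.7); the diagonal longitudinal moment itself is `≤ 0` by an2's `diag_second_moment_nonpos`), `tsum_diag_sq_flipK` (the diagonal longitudinal moment is flip-blind); §2 the β-lead's pinned family
`JsBalAn1(r; c⃗; cE₂; cB; T)` at level `j` under `hW_j` (any root, colours, `cE₂`, `cB`, `T`): **`secondMoment_TbalOf_JsBalAn1_eq_neg_half_of_hW`**, `…_eq_neg_half_left_of_hW`, `…_eq_neg_quarter_of_hW`,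
**`secondMoment_TbalOf_JsBalAn1_nonneg_of_hW_convPSD`**; §3 at the pin: **`d1Drift_iff_tendsto_longitudinal_of_hW`**, `d1Drift_iff_lim_longitudinal_of_hW`, **`lim_secondMoment_nonneg_of_hW_convPSD`**,
`not_d1Drift_of_stepBal_neg_of_hW_convPSD`; §4 the b2b wall's (III′) literal `JsB12CombShSym hLc N tabs cΛ cB` over every table record: the three level-`j` statements of §2.

Provenance: cell pub-balaban-gaps, seat g1-p1 GEN 17 (prover-pub-balaban-gaps-g1-p1-g17-0), 2026-08-25; imports GEN 15's `Gaps/D1ParityOddFirstMoments` (p393693 ✓) only (through it: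
`D1IndexSymmetryDictionary`, `D1PinnedIndexSymmetry`, `D1RecordIndexSymmetry`, `D1PinnedResponseTowers`, `CapTailPinnedLimitSign`, `PolarizationSign`); no existing file touched.
-/

noncomputable section

open Literature.MathematicalPhysics.QuantumFieldTheory Balaban1983to89 Balaban1983to89.Beta Filter Topology
open OneStepResolventKernel (JetData)
open OneStepKernelFamily (TbalOf flipK D1Drift secondMoment_flipK)
open PolarizationSign (IndexSymmetric WardTransversal MomentSummable ConvPSD secondMoment_comm secondMoment_eq_neg_half secondMoment_nonneg)
open OddMoments (firstMoment)
open AffineAveraging (box)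
open RateCertificate (CauchyRate)
open Summit.QuantumFields.BalabanUV.Beta.MixedJetTablesPlug (JsBalAn1)
open Summit.QuantumFields.BalabanUV.Beta.CombChartJointEnd (JsB12CombShSym)
open Summit.QuantumFields.BalabanUV.Beta.SymmetrisedStepJets (SymTables)
open Summit.QuantumFields.BalabanUV.Beta.GAN24.StencilSlotOfE3 (one_le_of_two_le)
open Summit.QuantumFields.BalabanUV.Gaps.D1IndexSymmetryDictionary (momentSummable_flipK_TbalOf)
open Summit.QuantumFields.BalabanUV.Gaps.D1PinnedIndexSymmetry (indexSymmetric_flipK_TbalOf_JsBalAn1)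
open Summit.QuantumFields.BalabanUV.Gaps.D1RecordIndexSymmetry (indexSymmetric_flipK_TbalOf_JsB12CombShSym)
open Summit.QuantumFields.BalabanUV.Gaps.D1ParityOddFirstMoments (firstMoment_eq_zero_of_ward_indexSymmetric_of_not_injective)
open Summit.QuantumFields.BalabanUV.Gaps.CapTailPinnedLimitSign (tendsto_pinned d1Drift_pinned_iff_lim_eq)

namespace Summit.QuantumFields.BalabanUV.Gaps.D1WardLongitudinalForm

/-! ## §1 Generic kernels: the β sub-cell's Lemma 5.2 identities with the reflection input replaced by (5.8) + (5.9) -/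

section Generic

variable {d : ℕ}

/-- [folklore] THE FIRST-MOMENT INPUT OF `PolarizationSign.secondMoment_eq_neg_half` FROM (5.9) + (5.8) (no (5.7)): `Σ_z P_{αβ}(z) z_β = 0` for EVERY `α, β` — GEN 15's repeated-label law
`firstMoment_eq_zero_of_ward_indexSymmetric_of_not_injective` read at the triple `(α, β, β)`. -/
theorem firstMoment_inPlane_eq_zero {P : B12Beta.Kernel d} (hP : MomentSummable P 3) (hT : WardTransversal P) (hS : IndexSymmetric P) (α β : Fin d) :
    ∑' z, P α β z * (z β : ℝ) = 0 :=
  firstMoment_eq_zero_of_ward_indexSymmetric_of_not_injective hP hT hS (μ := α) (ν := β) (γ := β) (Or.inr (Or.inr rfl))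

/-- [folklore] **(1.22) ON THE RIGHT DIAGONAL CHANNEL, FROM (5.9) + (5.8) ALONE**: `secondMoment P α β = −½ Σ_z P_{ββ}(z) z_α²` (`α ≠ β`; summable third moments) — the β sub-cell's
`secondMoment_eq_neg_half` with its first-moment hypothesis DISCHARGED by `firstMoment_inPlane_eq_zero`; the reflection covariance (5.7) is NOT used. -/
theorem secondMoment_eq_neg_half_of_ward_indexSymmetric {P : B12Beta.Kernel d} (hP : MomentSummable P 3) (hT : WardTransversal P) (hS : IndexSymmetric P) {α β : Fin d}
    (hαβ : α ≠ β) : B12Beta.secondMoment P α β = -(1 / 2) * ∑' z, P β β z * (z α : ℝ) ^ 2 :=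
  secondMoment_eq_neg_half hP hT hαβ (firstMoment_inPlane_eq_zero hP hT hS α β)

/-- [folklore] … and ON THE LEFT DIAGONAL CHANNEL: `secondMoment P α β = −½ Σ_z P_{αα}(z) z_β²` (`α ≠ β`) — the previous identity for the pair `(β, α)` and (5.8)'s `secondMoment_comm`. -/
theorem secondMoment_eq_neg_half_left_of_ward_indexSymmetric {P : B12Beta.Kernel d} (hP : MomentSummable P 3) (hT : WardTransversal P) (hS : IndexSymmetric P) {α β : Fin d}
    (hαβ : α ≠ β) : B12Beta.secondMoment P α β = -(1 / 2) * ∑' z, P α α z * (z β : ℝ) ^ 2 := by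
  rw [secondMoment_comm hS α β]
  exact secondMoment_eq_neg_half_of_ward_indexSymmetric hP hT hS hαβ.symm

/-- [folklore] **THE SYMMETRIC FORM OF (1.22) FROM (5.9) + (5.8) ALONE**: `secondMoment P α β = −¼ (Σ_z P_{ββ}(z) z_α² + Σ_z P_{αα}(z) z_β²)` (`α ≠ β`) — the β sub-cell's
`secondMoment_eq_neg_quarter` WITHOUT its hypothesis `AxisReflectionCovariant P`. -/
theorem secondMoment_eq_neg_quarter_of_ward_indexSymmetric {P : B12Beta.Kernel d} (hP : MomentSummable P 3) (hT : WardTransversal P) (hS : IndexSymmetric P) {α β : Fin d}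
    (hαβ : α ≠ β) : B12Beta.secondMoment P α β = -(1 / 4) * (∑' z, P β β z * (z α : ℝ) ^ 2 + ∑' z, P α α z * (z β : ℝ) ^ 2) := by
  have h1 := secondMoment_eq_neg_half_of_ward_indexSymmetric hP hT hS hαβ
  have h2 := secondMoment_eq_neg_half_left_of_ward_indexSymmetric hP hT hS hαβ
  linarith

/-- [folklore] THE TWO DIAGONAL READINGS AGREE: under (5.9) + (5.8) + summable third moments `Σ_z P_{ββ}(z) z_α² = Σ_z P_{αα}(z) z_β²` for `α ≠ β` — the longitudinal second moment of the
diagonal channel `β` along `α` equals that of the diagonal channel `α` along `β`. -/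
theorem longitudinalMoment_diag_comm {P : B12Beta.Kernel d} (hP : MomentSummable P 3) (hT : WardTransversal P) (hS : IndexSymmetric P) {α β : Fin d} (hαβ : α ≠ β) :
    ∑' z, P β β z * (z α : ℝ) ^ 2 = ∑' z, P α α z * (z β : ℝ) ^ 2 := by
  have h1 := secondMoment_eq_neg_half_of_ward_indexSymmetric hP hT hS hαβ
  have h2 := secondMoment_eq_neg_half_left_of_ward_indexSymmetric hP hT hS hαβ
  linarith

/-- [folklore] **THE β SUB-CELL's LEMMA 5.2 WITHOUT THE REFLECTION COVARIANCE**: PSD convolution form + (5.9) + (5.8) + summable third moments ⟹ `0 ≤ secondMoment P α β` (`α ≠ β`) —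
`PolarizationSign.secondMoment_nonneg` with its first-moment hypothesis discharged by `firstMoment_inPlane_eq_zero` (compare `secondMoment_nonneg_of_reflection`, which takes (5.7)). -/
theorem secondMoment_nonneg_of_ward_indexSymmetric_convPSD {P : B12Beta.Kernel d} (hP : MomentSummable P 3) (hT : WardTransversal P) (hS : IndexSymmetric P) (hPSD : ConvPSD P)
    {α β : Fin d} (hαβ : α ≠ β) : 0 ≤ B12Beta.secondMoment P α β :=
  secondMoment_nonneg hP hT hPSD hαβ (firstMoment_inPlane_eq_zero hP hT hS α β)

/-- [folklore] The diagonal longitudinal moment is blind to the flip `z ↦ −z` (re-indexing the lattice sum by `Equiv.neg`; no summability needed). -/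
theorem tsum_diag_sq_flipK (T : B12Beta.Kernel d) (β α : Fin d) : ∑' z, flipK T β β z * (z α : ℝ) ^ 2 = ∑' z, T β β z * (z α : ℝ) ^ 2 := by
  rw [← (Equiv.neg (Fin d → ℤ)).tsum_eq (fun x => T β β x * (x α : ℝ) ^ 2)]
  refine tsum_congr fun x => ?_
  simp only [OneStepKernelFamily.flipK_apply, Equiv.neg_apply, Pi.neg_apply, Int.cast_neg, neg_sq]

end Generic

/-! ## §2 The β-lead's pinned family at one level under `hW_j`: the (1.22) coefficient on a diagonal channel, and its sign -/

section Pinned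

variable {Lc : ℕ} [NeZero Lc] {r : Fin (3 + 1) → ℕ}

/-- [folklore] **UNDER THE WARD BINDER AT LEVEL `j` THE (1.22) COEFFICIENT OF THE PINNED FAMILY IS −½ THE LONGITUDINAL SECOND MOMENT OF THE RIGHT DIAGONAL CHANNEL**:
`β⁰_j(μ,ν) = secondMoment (T_j) μ ν = −½ Σ_z T_j(ν,ν,z) z_μ²` (`μ ≠ ν`; any box root, colour triple, `cE₂`, `cB`, `T`), `T_j := TbalOf Lc (JsBalAn1 …) j`; (5.8) by GEN 14, moment summability by
`momentSummable_flipK_TbalOf`, the flip removed by `secondMoment_flipK` ∕ `tsum_diag_sq_flipK`.  The reflection binder `hR` is NOT used. -/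
theorem secondMoment_TbalOf_JsBalAn1_eq_neg_half_of_hW (hLc : 1 ≤ Lc) (hr : r ∈ box (3 + 1) Lc) (cE cVH cΛ cE₂ cB : ℝ) (T : Fin 4 → Fin 4 → Fin 4 → Fin 4 → ℝ) (j : ℕ)
    (hW : WardTransversal (flipK (TbalOf Lc (JsBalAn1 hLc hr cE cVH cΛ cE₂ cB T) j))) {μ ν : Fin 4} (hμν : μ ≠ ν) :
    B12Beta.secondMoment (TbalOf Lc (JsBalAn1 hLc hr cE cVH cΛ cE₂ cB T) j) μ ν = -(1 / 2) * ∑' z, TbalOf Lc (JsBalAn1 hLc hr cE cVH cΛ cE₂ cB T) j ν ν z * (z μ : ℝ) ^ 2 := by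
  rw [← secondMoment_flipK, ← tsum_diag_sq_flipK]
  exact secondMoment_eq_neg_half_of_ward_indexSymmetric (momentSummable_flipK_TbalOf _ j 3) hW (indexSymmetric_flipK_TbalOf_JsBalAn1 hLc hr cE cVH cΛ cE₂ cB T j) hμν

/-- [folklore] … the same ON THE LEFT DIAGONAL CHANNEL: `β⁰_j(μ,ν) = −½ Σ_z T_j(μ,μ,z) z_ν²`. -/
theorem secondMoment_TbalOf_JsBalAn1_eq_neg_half_left_of_hW (hLc : 1 ≤ Lc) (hr : r ∈ box (3 + 1) Lc) (cE cVH cΛ cE₂ cB : ℝ) (T : Fin 4 → Fin 4 → Fin 4 → Fin 4 → ℝ) (j : ℕ)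
    (hW : WardTransversal (flipK (TbalOf Lc (JsBalAn1 hLc hr cE cVH cΛ cE₂ cB T) j))) {μ ν : Fin 4} (hμν : μ ≠ ν) :
    B12Beta.secondMoment (TbalOf Lc (JsBalAn1 hLc hr cE cVH cΛ cE₂ cB T) j) μ ν = -(1 / 2) * ∑' z, TbalOf Lc (JsBalAn1 hLc hr cE cVH cΛ cE₂ cB T) j μ μ z * (z ν : ℝ) ^ 2 := by
  rw [← secondMoment_flipK, ← tsum_diag_sq_flipK]
  exact secondMoment_eq_neg_half_left_of_ward_indexSymmetric (momentSummable_flipK_TbalOf _ j 3) hW (indexSymmetric_flipK_TbalOf_JsBalAn1 hLc hr cE cVH cΛ cE₂ cB T j) hμν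

/-- [folklore] … and the symmetric form `β⁰_j(μ,ν) = −¼ (Σ_z T_j(ν,ν,z) z_μ² + Σ_z T_j(μ,μ,z) z_ν²)`. -/
theorem secondMoment_TbalOf_JsBalAn1_eq_neg_quarter_of_hW (hLc : 1 ≤ Lc) (hr : r ∈ box (3 + 1) Lc) (cE cVH cΛ cE₂ cB : ℝ) (T : Fin 4 → Fin 4 → Fin 4 → Fin 4 → ℝ) (j : ℕ)
    (hW : WardTransversal (flipK (TbalOf Lc (JsBalAn1 hLc hr cE cVH cΛ cE₂ cB T) j))) {μ ν : Fin 4} (hμν : μ ≠ ν) :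
    B12Beta.secondMoment (TbalOf Lc (JsBalAn1 hLc hr cE cVH cΛ cE₂ cB T) j) μ ν =
      -(1 / 4) * (∑' z, TbalOf Lc (JsBalAn1 hLc hr cE cVH cΛ cE₂ cB T) j ν ν z * (z μ : ℝ) ^ 2 + ∑' z, TbalOf Lc (JsBalAn1 hLc hr cE cVH cΛ cE₂ cB T) j μ μ z * (z ν : ℝ) ^ 2) := by
  have h1 := secondMoment_TbalOf_JsBalAn1_eq_neg_half_of_hW hLc hr cE cVH cΛ cE₂ cB T j hW hμν
  have h2 := secondMoment_TbalOf_JsBalAn1_eq_neg_half_left_of_hW hLc hr cE cVH cΛ cE₂ cB T j hW hμν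
  linarith

/-- [folklore] **THE β SUB-CELL's LEMMA 5.2 AT THE PINNED FAMILY, LEVEL BY LEVEL, WITHOUT `hR`**: if the flipped step kernel at level `j` is Ward-transversal and its convolution form is PSD,
then `0 ≤ β⁰_j(μ,ν)` (`μ ≠ ν`). -/
theorem secondMoment_TbalOf_JsBalAn1_nonneg_of_hW_convPSD (hLc : 1 ≤ Lc) (hr : r ∈ box (3 + 1) Lc) (cE cVH cΛ cE₂ cB : ℝ) (T : Fin 4 → Fin 4 → Fin 4 → Fin 4 → ℝ) (j : ℕ)
    (hW : WardTransversal (flipK (TbalOf Lc (JsBalAn1 hLc hr cE cVH cΛ cE₂ cB T) j))) (hPSD : ConvPSD (flipK (TbalOf Lc (JsBalAn1 hLc hr cE cVH cΛ cE₂ cB T) j)))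
    {μ ν : Fin 4} (hμν : μ ≠ ν) : 0 ≤ B12Beta.secondMoment (TbalOf Lc (JsBalAn1 hLc hr cE cVH cΛ cE₂ cB T) j) μ ν := by
  rw [← secondMoment_flipK]
  exact secondMoment_nonneg_of_ward_indexSymmetric_convPSD (momentSummable_flipK_TbalOf _ j 3) hW (indexSymmetric_flipK_TbalOf_JsBalAn1 hLc hr cE cVH cΛ cE₂ cB T j) hPSD hμν

end Pinned

/-! ## §3 At the pin `cE₂ := Lc^8`, `2 ≤ Lc`: (D1) under `∀ j, hW_j` reads on one diagonal channel; the constructed limit is `≥ 0` under `hW + PSD` -/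

section Pin

variable {Lc : ℕ} [NeZero Lc] {r : Fin (3 + 1) → ℕ}

/-- [folklore] **(D1) UNDER THE WARD BINDER IS A STATEMENT ABOUT ONE DIAGONAL CHANNEL**: at the pin, if every level's flipped step kernel is Ward-transversal, then
`D1Drift Lc (JsBalAn1 …) N μ ν` ⟺ the longitudinal second moments `Σ_z T_j(ν,ν,z) z_μ²` of the diagonal channel `ν` TEND TO `−2·stepBal N Lc` (`μ ≠ ν`; the convergence of `β⁰_j` itself is
g1-p3's hypothesis-free `tendsto_pinned`). -/
theorem d1Drift_iff_tendsto_longitudinal_of_hW (hLc : 2 ≤ Lc) (hr : r ∈ box (3 + 1) Lc) (cE cVH cΛ cB : ℝ) (Tc : Fin 4 → Fin 4 → Fin 4 → Fin 4 → ℝ) {μ ν : Fin 4} (hμν : μ ≠ ν) (N : ℝ)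
    (hW : ∀ j : ℕ, WardTransversal (flipK (TbalOf Lc (JsBalAn1 (one_le_of_two_le hLc) hr cE cVH cΛ ((Lc : ℝ) ^ (2 * (3 + 1))) cB Tc) j))) :
    D1Drift Lc (JsBalAn1 (one_le_of_two_le hLc) hr cE cVH cΛ ((Lc : ℝ) ^ (2 * (3 + 1))) cB Tc) N μ ν ↔
      Tendsto (fun j => ∑' z, TbalOf Lc (JsBalAn1 (one_le_of_two_le hLc) hr cE cVH cΛ ((Lc : ℝ) ^ (2 * (3 + 1))) cB Tc) j ν ν z * (z μ : ℝ) ^ 2) atTop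
        (𝓝 (-2 * B12Normalization.stepBal N Lc)) := by
  have hL : (fun j => ∑' z, TbalOf Lc (JsBalAn1 (one_le_of_two_le hLc) hr cE cVH cΛ ((Lc : ℝ) ^ (2 * (3 + 1))) cB Tc) j ν ν z * (z μ : ℝ) ^ 2) =
      fun j => -2 * B12Beta.secondMoment (TbalOf Lc (JsBalAn1 (one_le_of_two_le hLc) hr cE cVH cΛ ((Lc : ℝ) ^ (2 * (3 + 1))) cB Tc) j) μ ν := by
    funext j
    rw [secondMoment_TbalOf_JsBalAn1_eq_neg_half_of_hW (one_le_of_two_le hLc) hr cE cVH cΛ _ cB Tc j (hW j) hμν]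
    ring
  have ht := tendsto_pinned hLc hr cE cVH cΛ cB Tc μ ν
  rw [d1Drift_pinned_iff_lim_eq hLc hr, hL]
  constructor
  · intro h
    rw [← h]
    exact ht.const_mul (-2)
  · intro h
    have h2 := tendsto_nhds_unique (ht.const_mul (-2 : ℝ)) h
    linarith

/-- [folklore] … equivalently (the `CauchyRate.lim` form): under `∀ j, hW_j`, `D1Drift … N μ ν` ⟺ `CauchyRate.lim (j ↦ Σ_z T_j(ν,ν,z) z_μ²) = −2·stepBal N Lc`. -/
theorem d1Drift_iff_lim_longitudinal_of_hW (hLc : 2 ≤ Lc) (hr : r ∈ box (3 + 1) Lc) (cE cVH cΛ cB : ℝ) (Tc : Fin 4 → Fin 4 → Fin 4 → Fin 4 → ℝ) {μ ν : Fin 4} (hμν : μ ≠ ν) (N : ℝ)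
    (hW : ∀ j : ℕ, WardTransversal (flipK (TbalOf Lc (JsBalAn1 (one_le_of_two_le hLc) hr cE cVH cΛ ((Lc : ℝ) ^ (2 * (3 + 1))) cB Tc) j))) :
    D1Drift Lc (JsBalAn1 (one_le_of_two_le hLc) hr cE cVH cΛ ((Lc : ℝ) ^ (2 * (3 + 1))) cB Tc) N μ ν ↔
      CauchyRate.lim (fun j => ∑' z, TbalOf Lc (JsBalAn1 (one_le_of_two_le hLc) hr cE cVH cΛ ((Lc : ℝ) ^ (2 * (3 + 1))) cB Tc) j ν ν z * (z μ : ℝ) ^ 2) =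
        -2 * B12Normalization.stepBal N Lc := by
  have hL : (fun j => ∑' z, TbalOf Lc (JsBalAn1 (one_le_of_two_le hLc) hr cE cVH cΛ ((Lc : ℝ) ^ (2 * (3 + 1))) cB Tc) j ν ν z * (z μ : ℝ) ^ 2) =
      fun j => -2 * B12Beta.secondMoment (TbalOf Lc (JsBalAn1 (one_le_of_two_le hLc) hr cE cVH cΛ ((Lc : ℝ) ^ (2 * (3 + 1))) cB Tc) j) μ ν := by
    funext j
    rw [secondMoment_TbalOf_JsBalAn1_eq_neg_half_of_hW (one_le_of_two_le hLc) hr cE cVH cΛ _ cB Tc j (hW j) hμν]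
    ring
  have ht := tendsto_pinned hLc hr cE cVH cΛ cB Tc μ ν
  have hlim : CauchyRate.lim (fun j => ∑' z, TbalOf Lc (JsBalAn1 (one_le_of_two_le hLc) hr cE cVH cΛ ((Lc : ℝ) ^ (2 * (3 + 1))) cB Tc) j ν ν z * (z μ : ℝ) ^ 2) =
      -2 * CauchyRate.lim (fun j => B12Beta.secondMoment (TbalOf Lc (JsBalAn1 (one_le_of_two_le hLc) hr cE cVH cΛ ((Lc : ℝ) ^ (2 * (3 + 1))) cB Tc) j) μ ν) := by
    rw [hL]
    exact (ht.const_mul (-2)).limUnder_eq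
  rw [d1Drift_pinned_iff_lim_eq hLc hr, hlim]
  constructor
  · intro h; rw [h]
  · intro h; linarith

/-- [folklore] **THE SIGN HALF OF LEMMA 5.2 REACHES THE (D1) LIMIT WITHOUT `hR`**: at the pin, if every level's flipped step kernel is Ward-transversal with a PSD convolution form, the
constructed limit `lim β⁰(μ,ν)` is `≥ 0` (`μ ≠ ν`). -/
theorem lim_secondMoment_nonneg_of_hW_convPSD (hLc : 2 ≤ Lc) (hr : r ∈ box (3 + 1) Lc) (cE cVH cΛ cB : ℝ) (Tc : Fin 4 → Fin 4 → Fin 4 → Fin 4 → ℝ) {μ ν : Fin 4} (hμν : μ ≠ ν)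
    (hW : ∀ j : ℕ, WardTransversal (flipK (TbalOf Lc (JsBalAn1 (one_le_of_two_le hLc) hr cE cVH cΛ ((Lc : ℝ) ^ (2 * (3 + 1))) cB Tc) j)))
    (hPSD : ∀ j : ℕ, ConvPSD (flipK (TbalOf Lc (JsBalAn1 (one_le_of_two_le hLc) hr cE cVH cΛ ((Lc : ℝ) ^ (2 * (3 + 1))) cB Tc) j))) :
    0 ≤ CauchyRate.lim (fun j => B12Beta.secondMoment (TbalOf Lc (JsBalAn1 (one_le_of_two_le hLc) hr cE cVH cΛ ((Lc : ℝ) ^ (2 * (3 + 1))) cB Tc) j) μ ν) :=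
  ge_of_tendsto' (tendsto_pinned hLc hr cE cVH cΛ cB Tc μ ν) fun j =>
    secondMoment_TbalOf_JsBalAn1_nonneg_of_hW_convPSD (one_le_of_two_le hLc) hr cE cVH cΛ _ cB Tc j (hW j) (hPSD j) hμν

/-- [folklore] … hence a member all of whose levels satisfy `hW_j ∧ PSD_j` cannot meet (D1) with a NEGATIVE target `stepBal N Lc < 0` (bookkeeping; for the printed numerals `stepBal N Lc > 0`
and this says nothing). -/
theorem not_d1Drift_of_stepBal_neg_of_hW_convPSD (hLc : 2 ≤ Lc) (hr : r ∈ box (3 + 1) Lc) (cE cVH cΛ cB : ℝ) (Tc : Fin 4 → Fin 4 → Fin 4 → Fin 4 → ℝ) {μ ν : Fin 4} (hμν : μ ≠ ν)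
    {N : ℝ} (hN : B12Normalization.stepBal N Lc < 0)
    (hW : ∀ j : ℕ, WardTransversal (flipK (TbalOf Lc (JsBalAn1 (one_le_of_two_le hLc) hr cE cVH cΛ ((Lc : ℝ) ^ (2 * (3 + 1))) cB Tc) j)))
    (hPSD : ∀ j : ℕ, ConvPSD (flipK (TbalOf Lc (JsBalAn1 (one_le_of_two_le hLc) hr cE cVH cΛ ((Lc : ℝ) ^ (2 * (3 + 1))) cB Tc) j))) :
    ¬ D1Drift Lc (JsBalAn1 (one_le_of_two_le hLc) hr cE cVH cΛ ((Lc : ℝ) ^ (2 * (3 + 1))) cB Tc) N μ ν := by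
  rw [d1Drift_pinned_iff_lim_eq hLc hr]
  intro h
  have h0 := lim_secondMoment_nonneg_of_hW_convPSD hLc hr cE cVH cΛ cB Tc hμν hW hPSD
  rw [h] at h0
  exact absurd hN (not_lt.mpr h0)

end Pin

/-! ## §4 The b2b wall's (III′) literal `JsB12CombShSym hLc N tabs cΛ cB` over every table record: the level-`j` statements -/

section Record

variable {Lc : ℕ} [NeZero Lc]

/-- [folklore] **UNDER `hW_j` THE (1.22) COEFFICIENT OF THE (III′) LITERAL IS −½ THE LONGITUDINAL SECOND MOMENT OF THE RIGHT DIAGONAL CHANNEL** (every table record `tabs`, `N`, `cΛ`, `cB`,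
level; `Odd Lc`; `μ ≠ ν`); (5.8) by GEN 14's `indexSymmetric_flipK_TbalOf_JsB12CombShSym`; `hR` NOT used. -/
theorem secondMoment_TbalOf_JsB12CombShSym_eq_neg_half_of_hW (hLc : Odd Lc) (N : ℕ) (tabs : SymTables 3 Lc) (cΛ cB : ℝ) (j : ℕ)
    (hW : WardTransversal (flipK (TbalOf Lc (JsB12CombShSym hLc N tabs cΛ cB) j))) {μ ν : Fin 4} (hμν : μ ≠ ν) :
    B12Beta.secondMoment (TbalOf Lc (JsB12CombShSym hLc N tabs cΛ cB) j) μ ν = -(1 / 2) * ∑' z, TbalOf Lc (JsB12CombShSym hLc N tabs cΛ cB) j ν ν z * (z μ : ℝ) ^ 2 := by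
  rw [← secondMoment_flipK, ← tsum_diag_sq_flipK]
  exact secondMoment_eq_neg_half_of_ward_indexSymmetric (momentSummable_flipK_TbalOf _ j 3) hW (indexSymmetric_flipK_TbalOf_JsB12CombShSym hLc N tabs cΛ cB j) hμν

/-- [folklore] … the symmetric form at the (III′) literal: `β⁰_j(μ,ν) = −¼ (Σ_z T_j(ν,ν,z) z_μ² + Σ_z T_j(μ,μ,z) z_ν²)`. -/
theorem secondMoment_TbalOf_JsB12CombShSym_eq_neg_quarter_of_hW (hLc : Odd Lc) (N : ℕ) (tabs : SymTables 3 Lc) (cΛ cB : ℝ) (j : ℕ)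
    (hW : WardTransversal (flipK (TbalOf Lc (JsB12CombShSym hLc N tabs cΛ cB) j))) {μ ν : Fin 4} (hμν : μ ≠ ν) :
    B12Beta.secondMoment (TbalOf Lc (JsB12CombShSym hLc N tabs cΛ cB) j) μ ν =
      -(1 / 4) * (∑' z, TbalOf Lc (JsB12CombShSym hLc N tabs cΛ cB) j ν ν z * (z μ : ℝ) ^ 2 + ∑' z, TbalOf Lc (JsB12CombShSym hLc N tabs cΛ cB) j μ μ z * (z ν : ℝ) ^ 2) := by
  rw [← secondMoment_flipK, ← tsum_diag_sq_flipK, ← tsum_diag_sq_flipK (TbalOf Lc (JsB12CombShSym hLc N tabs cΛ cB) j) μ ν]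
  exact secondMoment_eq_neg_quarter_of_ward_indexSymmetric (momentSummable_flipK_TbalOf _ j 3) hW (indexSymmetric_flipK_TbalOf_JsB12CombShSym hLc N tabs cΛ cB j) hμν

/-- [folklore] **LEMMA 5.2 AT THE (III′) LITERAL, LEVEL BY LEVEL, WITHOUT `hR`**: `hW_j` + PSD of the flipped level-`j` kernel ⟹ `0 ≤ β⁰_j(μ,ν)` (`μ ≠ ν`). -/
theorem secondMoment_TbalOf_JsB12CombShSym_nonneg_of_hW_convPSD (hLc : Odd Lc) (N : ℕ) (tabs : SymTables 3 Lc) (cΛ cB : ℝ) (j : ℕ)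
    (hW : WardTransversal (flipK (TbalOf Lc (JsB12CombShSym hLc N tabs cΛ cB) j))) (hPSD : ConvPSD (flipK (TbalOf Lc (JsB12CombShSym hLc N tabs cΛ cB) j)))
    {μ ν : Fin 4} (hμν : μ ≠ ν) : 0 ≤ B12Beta.secondMoment (TbalOf Lc (JsB12CombShSym hLc N tabs cΛ cB) j) μ ν := by
  rw [← secondMoment_flipK]
  exact secondMoment_nonneg_of_ward_indexSymmetric_convPSD (momentSummable_flipK_TbalOf _ j 3) hW (indexSymmetric_flipK_TbalOf_JsB12CombShSym hLc N tabs cΛ cB j) hPSD hμν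

end Record

end Summit.QuantumFields.BalabanUV.Gaps.D1WardLongitudinalForm

end
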